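import Summits.ResolutionOfSingularities.ResolutionOfSingularities.Theorems.EquisingularLiftEquisingularLiftNatNDInvariants
import Literature.RingTheory.Flat.RegularFibreFlat
import Literature.AlgebraicGeometry.Resolution.OriginLocalRing
import Mathlib.RingTheory.RingHom.Flat
import HarnessLib

/-!
# [OURS · L1 W4.5(b) · EL♮(3)] ND-K5 (W-β2a/b) FRAME-CHART FLATNESS — the frame chart `t ↦ w` at a point with local ND frame data is FLAT,
# sends the origin ideal onto the maximal ideal and pulls the maximal ideal back to the origin ideal

OURS · L1 W4.5(b) · EL♮(3) stmt-ResolutionOfSingularities-20148 (parent EL♮ stmt-…-20038) · counted 0 · AI-written (res-L1-w45b-iso-w2 g0, WIDTH seat on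
D-0157 DOOR 1; statements = res-L1-w45b-lead-2's WIDTH TABLE D1 row iso-w2, sig file `FrameChartFlat-sig.lean` 20c374cace242034, VERBATIM), weaker than expert
review; nothing of [Hironaka2017] asserted; no statement of the manuscript; resolution of singularities in positive characteristic is NOT proved here or by this.
Def-free, sorry-free, standard axioms. `--supports stmt-ResolutionOfSingularities-20148 --as helper`.

WHAT.  For a scheme `ρ : F → ℙⁿ_k`, a point `x ∈ F` with Noetherian stalk `𝒪_{F,x}` and `w₁, …, wₙ ∈ 𝒪_{F,x}` generating the maximal ideal of the
`n`-dimensional local ring `𝒪_{F,x}` (so `𝒪_{F,x}` is regular with r.s.p. `w` — these are the frame-data clauses of `ND.IsNDFrameAt`), the FRAME CHART is the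
ring map `φ : k[X₁, …, Xₙ] → 𝒪_{F,x}`, `Xᵢ ↦ wᵢ`, constants through the structure map `ND.baseToStalk` (= `MvPolynomial.eval₂Hom (ND.baseToStalk n k ρ x) w`).

* `ND.map_originIdeal_frameChart` (W-β2b): `φ((X₁, …, Xₙ)) · 𝒪_{F,x} = 𝔪ₓ` and `φ⁻¹(𝔪ₓ) = (X₁, …, Xₙ)` (the origin ideal is maximal and maps into `𝔪ₓ`).
* `ND.flat_frameChart` (W-β2a): `φ` is FLAT.  Proof: `φ` factors through the local ring of `𝔸ⁿ_k` at the origin, `k[X] → k[X]_{(X)} → 𝒪_{F,x}`; the first arrow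
  is a localization (flat), the second is a LOCAL homomorphism of Noetherian local rings out of the regular local ring `k[X]_{(X)}` of dimension `n`
  (`Literature…OriginLocalization.isRegularLocalRing`, `ringKrullDim_originLocalization`) whose closed fibre `𝒪_{F,x}/𝔪ₓ` is a field (regular of dimension
  `0`) and `dim k[X]_{(X)} + 0 ≤ dim 𝒪_{F,x} = n`, hence flat by Matsumura's Thm. 23.1 for a regular fibre
  (`Literature.RingTheory.Flat.flat_of_isRegularLocalRing_of_isRegularLocalRing_fiber`); flatness is stable under composition.

FEEDS.  (B4β)/(B4β2) `ND.transportRound` of the ND-K5 deal: the étale-type transport of the model toric round along the frame chart needs exactly this flatness as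
the input of `Literature…IsBlowup.of_isPullback_of_flat` / `StrictTransformBaseChange` (blow-ups and strict transforms commute with flat base change).
-/

set_option linter.dupNamespace false

open CategoryTheory CategoryTheory.Limits AlgebraicGeometry TopologicalSpace Topology
open MvPolynomial
open Literature.AlgebraicGeometry.Resolution
open AlgebraicGeometry.Scheme.IdealSheafData

namespace Summit.ResolutionOfSingularities.ResolutionOfSingularities.Cruxes.EquisingularLiftNat.Sections.ND

/-- **(W-β2b)** The frame chart `k[X₁, …, Xₙ] → 𝒪_{F,x}`, `Xᵢ ↦ wᵢ`, sends the origin ideal `(X₁, …, Xₙ)` ONTO the maximal ideal `𝔪ₓ = (w₁, …, wₙ)` and pulls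
the maximal ideal back to the origin ideal (the origin ideal is maximal and is mapped into `𝔪ₓ`). [OURS · L1 W4.5b · ND-K5 (W-β2b)] -/
theorem map_originIdeal_frameChart (n : ℕ) (k : Type) [Field k] (F : AlgebraicGeometry.Scheme.{0})
    (ρ : F ⟶ (Literature.AlgebraicGeometry.Motives.projectiveSpace n k).left) (x : F)
    (w : Fin n → F.presheaf.stalk x)
    (hw : Ideal.span (Set.range w) = IsLocalRing.maximalIdeal (F.presheaf.stalk x)) :
    Ideal.map (MvPolynomial.eval₂Hom (baseToStalk n k ρ x) w) (Literature.AlgebraicGeometry.Resolution.originIdeal k n) =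
      IsLocalRing.maximalIdeal (F.presheaf.stalk x) ∧
    Ideal.comap (MvPolynomial.eval₂Hom (baseToStalk n k ρ x) w) (IsLocalRing.maximalIdeal (F.presheaf.stalk x)) =
      Literature.AlgebraicGeometry.Resolution.originIdeal k n := by
  have hmap : Ideal.map (MvPolynomial.eval₂Hom (baseToStalk n k ρ x) w)
      (Literature.AlgebraicGeometry.Resolution.originIdeal k n) = IsLocalRing.maximalIdeal (F.presheaf.stalk x) := by
    rw [originIdeal_eq_span, Ideal.map_span, ← Set.range_comp]
    have hcomp : (⇑(MvPolynomial.eval₂Hom (baseToStalk n k ρ x) w) ∘ (X : Fin n → MvPolynomial (Fin n) k)) = w := by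
      funext i
      simp only [Function.comp_apply, MvPolynomial.coe_eval₂Hom, MvPolynomial.eval₂_X]
    rw [hcomp, hw]
  refine ⟨hmap, ?_⟩
  have hle : Literature.AlgebraicGeometry.Resolution.originIdeal k n ≤
      Ideal.comap (MvPolynomial.eval₂Hom (baseToStalk n k ρ x) w) (IsLocalRing.maximalIdeal (F.presheaf.stalk x)) :=
    Ideal.map_le_iff_le_comap.mp hmap.le
  have hne : Ideal.comap (MvPolynomial.eval₂Hom (baseToStalk n k ρ x) w) (IsLocalRing.maximalIdeal (F.presheaf.stalk x)) ≠ ⊤ :=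
    Ideal.comap_ne_top _ (IsLocalRing.maximalIdeal.isMaximal _).ne_top
  exact ((originIdeal.isMaximal k n).eq_of_le hne hle).symm

/-- **(W-β2a) THE FRAME CHART IS FLAT.**  At a point `x` of a scheme `F → ℙⁿ_k` whose Noetherian stalk `𝒪_{F,x}` has dimension `n` and maximal ideal generated
by `w₁, …, wₙ`, the ring map `k[X₁, …, Xₙ] → 𝒪_{F,x}`, `Xᵢ ↦ wᵢ`, is flat: it is the localization `k[X] → k[X]_{(X)}` followed by a local homomorphism of
Noetherian local rings out of a regular local ring of dimension `n` with field closed fibre and target of dimension `n` (Matsumura, Thm. 23.1 for a regular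
fibre, `Literature.RingTheory.Flat.flat_of_isRegularLocalRing_of_isRegularLocalRing_fiber`). [OURS · L1 W4.5b · ND-K5 (W-β2a)] -/
theorem flat_frameChart (n : ℕ) (k : Type) [Field k] (F : AlgebraicGeometry.Scheme.{0})
    (ρ : F ⟶ (Literature.AlgebraicGeometry.Motives.projectiveSpace n k).left) (x : F)
    [IsNoetherianRing (F.presheaf.stalk x)] (w : Fin n → F.presheaf.stalk x)
    (hw : Ideal.span (Set.range w) = IsLocalRing.maximalIdeal (F.presheaf.stalk x))
    (hdim : ringKrullDim (F.presheaf.stalk x) = n) :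
    (MvPolynomial.eval₂Hom (baseToStalk n k ρ x) w).Flat := by
  obtain ⟨hmap, hcomap⟩ := map_originIdeal_frameChart n k F ρ x w hw
  -- the frame chart inverts everything off the origin ideal
  have hunit : ∀ s : (Literature.AlgebraicGeometry.Resolution.originIdeal k n).primeCompl,
      IsUnit (MvPolynomial.eval₂Hom (baseToStalk n k ρ x) w s) := by
    intro s
    by_contra h
    have hs : (s : MvPolynomial (Fin n) k) ∈
        Ideal.comap (MvPolynomial.eval₂Hom (baseToStalk n k ρ x) w) (IsLocalRing.maximalIdeal (F.presheaf.stalk x)) :=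
      Ideal.mem_comap.mpr ((IsLocalRing.mem_maximalIdeal _).mpr h)
    rw [hcomap] at hs
    exact s.2 hs
  -- factor through the local ring of `𝔸ⁿ_k` at the origin
  set ψ : OriginLocalization k n →+* (F.presheaf.stalk x : Type _) :=
    IsLocalization.lift (M := (Literature.AlgebraicGeometry.Resolution.originIdeal k n).primeCompl) hunit
  have hψ : ψ.comp (algebraMap (MvPolynomial (Fin n) k) (OriginLocalization k n)) =
      MvPolynomial.eval₂Hom (baseToStalk n k ρ x) w :=
    IsLocalization.lift_comp hunit
  rw [← hψ]
  refine RingHom.Flat.comp ?_ ?_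
  · exact RingHom.flat_algebraMap_iff.mpr
      (IsLocalization.flat (OriginLocalization k n) (Literature.AlgebraicGeometry.Resolution.originIdeal k n).primeCompl)
  · -- the local homomorphism `k[X]_{(X)} → 𝒪_{F,x}`: Matsumura 23.1 with field fibre
    letI : Algebra (OriginLocalization k n) (F.presheaf.stalk x : Type _) := ψ.toAlgebra
    have halg : algebraMap (OriginLocalization k n) (F.presheaf.stalk x : Type _) = ψ := rfl
    have hmapψ : Ideal.map (algebraMap (OriginLocalization k n) (F.presheaf.stalk x : Type _))
        (IsLocalRing.maximalIdeal (OriginLocalization k n)) = IsLocalRing.maximalIdeal (F.presheaf.stalk x) := by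
      rw [halg, ← Localization.AtPrime.map_eq_maximalIdeal, Ideal.map_map, hψ, hmap]
    haveI : IsLocalHom (algebraMap (OriginLocalization k n) (F.presheaf.stalk x : Type _)) :=
      ((IsLocalRing.local_hom_TFAE _).out 2 0).mp hmapψ.le
    have hflat : Module.Flat (OriginLocalization k n) (F.presheaf.stalk x : Type _) := by
      refine Literature.RingTheory.Flat.flat_of_isRegularLocalRing_of_isRegularLocalRing_fiber ?_ ?_
      · rw [hmapψ]
        letI := Ideal.Quotient.field (IsLocalRing.maximalIdeal (F.presheaf.stalk x : Type _))
        infer_instance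
      · have h0 : ringKrullDim ((F.presheaf.stalk x : Type _) ⧸ IsLocalRing.maximalIdeal (F.presheaf.stalk x : Type _)) = 0 :=
          ringKrullDim_eq_zero_of_isField ((Ideal.Quotient.maximal_ideal_iff_isField_quotient _).mp inferInstance)
        rw [hmapψ, ringKrullDim_originLocalization, hdim, h0]
        simp
    show ψ.Flat
    rw [← halg]
    exact RingHom.flat_algebraMap_iff.mpr hflat

end Summit.ResolutionOfSingularities.ResolutionOfSingularities.Cruxes.EquisingularLiftNat.Sections.ND
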